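import Mathlib
import HarnessLib
import Summits.NavierStokesRegularity.NavierStokesRegularity.Theorems.TaylorModelRungThreeCertificateFormatVGrowth2Pairs

/-!
# Crux K1b-DR (stmt-NavierStokesRegularity-23954), line `taylor-model` — TWO-LEVEL growth checker (variant B), SOUNDNESS part 3:
# (R2) for all pairs and the composer's inputs (tm-g4 g4)

`vIn_transport`, `vIn_nonneg`, `wVec_nonneg2`, **`transport_bound2`** (across chunks with the two-level claims: in-chunk
sub-block transport to the chunk end, `ũ`, then `PchM`/`T̃` legs), `final_leg`, **`hR2_of_growth2`** (three cases: same
sub-block; same chunk via `vIn`; later chunk via `wVec`/`vOut`), and the all-stage bundles `hR2_all2`, `hR3a_all2`, `hR3b_all2`,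
`steps_of_growth2` (binders verbatim as in `readoutsV_of_checks'`; (R0)/(R1) are the one-level `hR0_all`/`hR1_all`). With these,
`CertTablesV.k1bDR_of_checksVRG2'` (CloserV) closes the crux from the two-level Booleans. MODEL-lattice bookkeeping only (rung
TL-M3); nothing here is a statement about the Navier–Stokes equations; K1b-DR is NOT proved here.
-/

-- the sub-problem namespace repeats the summit name by design (D-0017)
set_option linter.dupNamespace false

namespace Summit.NavierStokesRegularity.NavierStokesRegularity.Theorems.TaylorModelCert

open scoped BigOperators
open Literature.Analysis.FluidPDE.TaoCascade Literature.Analysis.FluidPDE.TaoCascade.TaylorChain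
open Summit.NavierStokesRegularity.NavierStokesRegularity.Theorems.TaylorModelReadout
open Summit.NavierStokesRegularity.NavierStokesRegularity.Theorems.TaylorModelV

namespace CertTablesV

variable {TV : CertTablesV} {kitOf : ℕ → CoreKit} {wT : ℕ → Array Dyad} {sc : ScalarsV}

section Stage2

variable {P : ℕ → CoreOut → Bool} {j L ℓ : ℕ} (hℓ : 0 < ℓ) (hdvd : ℓ ∣ L) (hL : 0 < L)
  (hGR : ∀ q, q * L < TV.S j → TV.growthRange2 kitOf wT P j L ℓ q = true)
include hℓ hdvd hL hGR

variable (hω : ∀ k, 0 < (TV.toCertDataVW kitOf wT sc).ω j k)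
include hω

omit hdvd hL hGR hω in
/-- **In-chunk transport of a start `a`**: bounded by `r·vIn a m` at the grid point `(a/ℓ+1)ℓ + mℓ`. [folklore] -/
theorem vIn_transport {a : ℕ} (m : ℕ) {Ac : ℕ → Ker}
    (hA : ∀ s', a ≤ s' → s' < (a / ℓ + 1) * ℓ + m * ℓ →
      KerMem (TV.toCertDataVW kitOf wT sc) (Ac s') ((TV.toBoxesW kitOf wT).Mlo j s') ((TV.toBoxesW kitOf wT).Mhi j s'))
    {v : Fin 4 → ℤ → ℝ} {r : ℝ} (hr : 0 ≤ r) (hv : (TV.toCertDataVW kitOf wT sc).InBall j v r) :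
    AbsLeW (TV.toCertDataVW kitOf wT sc) (kiter (TV.toCertDataVW kitOf wT sc) Ac a ((a / ℓ + 1) * ℓ + m * ℓ - a) v)
      (fun i k => r * vre (TV.vIn kitOf wT j ℓ a m) (TV.base.idx i k)) := by
  have hag : a ≤ (a / ℓ + 1) * ℓ := by have := Nat.lt_div_mul_add (a := a) hℓ; linarith
  unfold vIn
  exact vSub_transport (sc := sc) (j := j) hag hr _ m Ac (fun s' h1 h2 => hA s' (by omega) h2)
    (init_leg (sc := sc) hag (fun s' h1 h2 => hA s' h1 (by omega)) hr hv)

omit hℓ hdvd hL hGR in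
/-- `vIn ≥ 0`. [folklore] -/
theorem vIn_nonneg (a : ℕ) : ∀ m : ℕ, ∀ c < TV.base.n, 0 ≤ vre (TV.vIn kitOf wT j ℓ a m) c
  | 0, c, hc => by
    unfold vIn
    show 0 ≤ vre (absMulVecUp TV.base.n TV.prec _ (TV.ωhiV j)) c
    refine le_trans (Finset.sum_nonneg fun t ht => ?_) (sum_le_absMulVecUp TV.prec (fun r hr t ht => le_rfl) hc)
    exact mul_nonneg (magM_nonneg _ hc (Finset.mem_range.1 ht))
      ((hω _).le.trans (omega_le_ωhi (sc := sc) j (Finset.mem_range.1 ht)))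
  | m + 1, c, hc => by
    unfold vIn
    rw [vSub_succ]
    refine le_trans (Finset.sum_nonneg fun t ht => ?_) (sum_le_absMulVecUp TV.prec (fun r hr t ht => le_rfl) hc)
    exact mul_nonneg (magM_nonneg _ hc (Finset.mem_range.1 ht)) (vIn_nonneg a m t (Finset.mem_range.1 ht))

/-- The transported start vectors across chunks are nonnegative (two-level claims). [folklore] -/
theorem wVec_nonneg2 {s₀ : ℕ} :
    ∀ m : ℕ, (s₀ / L + 1 + m) * L < TV.S j → ∀ c < TV.base.n, vre (TV.wVec j L s₀ m) c ≥ 0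
  | 0, hm, c, hc => by
    have h1 : s₀ / L * L ≤ s₀ := Nat.div_mul_le_self s₀ L
    have h2 : s₀ < s₀ / L * L + L := Nat.lt_div_mul_add hL
    have hcl := (claims2_sound (TV := TV) (kitOf := kitOf) (wT := wT) hℓ hdvd (hGR (s₀ / L) (by nlinarith)) hL
      (by simpa using hm)).2 s₀ h1 (by linarith) c hc
    exact (vIn_nonneg (sc := sc) hω s₀ _ c hc).trans hcl
  | m + 1, hm, c, hc => by
    have hm' : (s₀ / L + 1 + m) * L < TV.S j := by nlinarith
    have ih := wVec_nonneg2 m hm'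
    have hcl := (claims2_sound (TV := TV) (kitOf := kitOf) (wT := wT) hℓ hdvd (hGR (s₀ / L + 1 + m) hm') hL
      (by simpa [Nat.add_assoc] using hm)).1
    show 0 ≤ vre (absMulVecUp TV.base.n TV.prec (TV.gT j (s₀ / L + 1 + m)) (TV.wVec j L s₀ m)) c
    refine le_trans (Finset.sum_nonneg fun t ht => ?_) (sum_le_absMulVecUp TV.prec (fun r hr t ht => le_rfl) hc)
    have ht' := Finset.mem_range.1 ht
    exact mul_nonneg ((magM_nonneg _ hc ht').trans (hcl c hc t ht')) (ih t ht')

/-- **TRANSPORT ACROSS CHUNKS** (two-level claims). [folklore] -/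
theorem transport_bound2 {s₀ : ℕ} :
    ∀ m : ℕ, (s₀ / L + 1 + m) * L < TV.S j → ∀ Ac : ℕ → Ker,
      (∀ s', s₀ ≤ s' → s' < (s₀ / L + 1 + m) * L →
        KerMem (TV.toCertDataVW kitOf wT sc) (Ac s') ((TV.toBoxesW kitOf wT).Mlo j s') ((TV.toBoxesW kitOf wT).Mhi j s')) →
      ∀ (v : Fin 4 → ℤ → ℝ) (r : ℝ), 0 ≤ r → (TV.toCertDataVW kitOf wT sc).InBall j v r →
        AbsLeW (TV.toCertDataVW kitOf wT sc) (kiter (TV.toCertDataVW kitOf wT sc) Ac s₀ ((s₀ / L + 1 + m) * L - s₀) v)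
          (fun i k => r * vre (TV.wVec j L s₀ m) (TV.base.idx i k)) ∧ 0 ≤ r
  | 0, hm, Ac, hA, v, r, hr, hv => by
    refine ⟨?_, hr⟩
    have h1 : s₀ / L * L ≤ s₀ := Nat.div_mul_le_self s₀ L
    have h2 : s₀ < s₀ / L * L + L := Nat.lt_div_mul_add hL
    have eC : (s₀ / L + 1) * L = s₀ / L * L + L := by ring
    simp only [Nat.add_zero] at hA hm ⊢
    -- in-chunk transport to the chunk end, then the claim `… ≤ ũ`
    have hg₀ : (s₀ / ℓ + 1) * ℓ ≤ (s₀ / L + 1) * L := by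
      have hd1 : ℓ ∣ (s₀ / L + 1) * L := Dvd.dvd.mul_left hdvd _
      have hd : s₀ / ℓ < (s₀ / L + 1) * L / ℓ :=
        (Nat.div_lt_iff_lt_mul hℓ).2 (by rw [Nat.div_mul_cancel hd1]; omega)
      have hm : (s₀ / ℓ + 1) * ℓ ≤ (s₀ / L + 1) * L / ℓ * ℓ := Nat.mul_le_mul_right ℓ hd
      rwa [Nat.div_mul_cancel hd1] at hm
    obtain ⟨m₁, hm₁⟩ : ∃ m₁, (s₀ / L + 1) * L - (s₀ / ℓ + 1) * ℓ = m₁ * ℓ := by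
      have hd1 : ℓ ∣ (s₀ / L + 1) * L := Dvd.dvd.mul_left hdvd _
      have hd2 : ℓ ∣ (s₀ / ℓ + 1) * ℓ := Dvd.intro_left _ rfl
      obtain ⟨c, hc⟩ := Nat.dvd_sub hd1 hd2
      exact ⟨c, by rw [hc, Nat.mul_comm]⟩
    have ht := vIn_transport (sc := sc) (j := j) (ℓ := ℓ) hℓ (a := s₀) m₁ (Ac := Ac)
      (fun s' h1' h2' => hA s' h1' (by omega)) hr hv
    rw [show (s₀ / ℓ + 1) * ℓ + m₁ * ℓ = (s₀ / L + 1) * L by omega] at ht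
    have hcl := (claims2_sound (TV := TV) (kitOf := kitOf) (wT := wT) hℓ hdvd (hGR (s₀ / L) (by nlinarith)) hL
      (by simpa using hm)).2 s₀ h1 (by linarith)
    have em₁ : ((s₀ / L + 1) * L - (s₀ / ℓ + 1) * ℓ) / ℓ = m₁ := by rw [hm₁]; exact Nat.mul_div_cancel m₁ hℓ
    rw [em₁] at hcl
    intro i k hk1 hk2
    refine (ht i k hk1 hk2).trans (mul_le_mul_of_nonneg_left (hcl _ (TV.base.idx_lt_n i ?_)) hr)
    rw [← cd_Kb (TV := TV) (kitOf := kitOf) (wT := wT) (sc := sc), ← cd_Ka (TV := TV) (kitOf := kitOf) (wT := wT) (sc := sc)]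
    exact ⟨hk1, hk2⟩
  | m + 1, hm, Ac, hA, v, r, hr, hv => by
    refine ⟨?_, hr⟩
    have h2 : s₀ < s₀ / L * L + L := Nat.lt_div_mul_add hL
    have hm' : (s₀ / L + 1 + m) * L < TV.S j := by nlinarith
    set q' := s₀ / L + 1 + m with hq'
    have hs₀q : s₀ ≤ q' * L := by nlinarith
    have ih := (transport_bound2 m hm' Ac (fun s' h1' h2' => hA s' h1' (by nlinarith)) v r hr hv).1
    have e1 : (s₀ / L + 1 + (m + 1)) * L - s₀ = (q' * L - s₀) + L / ℓ * ℓ := by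
      have : (s₀ / L + 1 + (m + 1)) * L = q' * L + L := by rw [hq']; ring
      rw [Nat.div_mul_cancel hdvd]; omega
    rw [e1, kiter_add, show s₀ + (q' * L - s₀) = q' * L by omega]
    have hLℓ : 1 ≤ L / ℓ := (Nat.le_div_iff_mul_le hℓ).2 (by simpa using Nat.le_of_dvd hL hdvd)
    have hmem := memMat_PchM (sc := sc) (j := j) (ℓ := ℓ) (C := q' * L) (Ac := Ac) (L / ℓ) hLℓ fun s' h1' h2' =>
      hA s' (by omega) (by rw [Nat.div_mul_cancel hdvd] at h2'; nlinarith)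
    have hK := TV.base.kerMem_of_memMat_kiter cd_Kb cd_Ka hmem
    have hb := absLeW_kiter_of_prodMem hK ih
    intro i' k' hk1' hk2'
    refine (hb i' k' hk1' hk2').trans ?_
    have hcl := (claims2_sound (TV := TV) (kitOf := kitOf) (wT := wT) hℓ hdvd (hGR q' hm') hL
      (by simpa [hq', Nat.add_assoc] using hm)).1
    have hwnn := wVec_nonneg2 (TV := TV) (kitOf := kitOf) (wT := wT) (sc := sc) hℓ hdvd hL hGR hω (s₀ := s₀) m hm'
    have hrow : ∀ r' < TV.base.n, ∑ t ∈ Finset.range TV.base.n,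
        (IntervalD.mag (imget (TV.PchM kitOf wT j ℓ (q' * L) (L / ℓ)) r' t)).toReal * (r * vre (TV.wVec j L s₀ m) t) ≤
        r * vre (TV.wVec j L s₀ (m + 1)) r' := by
      intro r' hr'
      have e : ∑ t ∈ Finset.range TV.base.n,
          (IntervalD.mag (imget (TV.PchM kitOf wT j ℓ (q' * L) (L / ℓ)) r' t)).toReal * (r * vre (TV.wVec j L s₀ m) t) =
          r * ∑ t ∈ Finset.range TV.base.n,
            (IntervalD.mag (imget (TV.PchM kitOf wT j ℓ (q' * L) (L / ℓ)) r' t)).toReal * vre (TV.wVec j L s₀ m) t := by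
        rw [Finset.mul_sum]; exact Finset.sum_congr rfl fun t _ => by ring
      rw [e]
      refine mul_le_mul_of_nonneg_left ?_ hr
      show _ ≤ vre (absMulVecUp TV.base.n TV.prec (TV.gT j (s₀ / L + 1 + m)) (TV.wVec j L s₀ m)) r'
      refine le_trans (Finset.sum_le_sum fun t ht => ?_) (sum_le_absMulVecUp TV.prec (fun r hr t ht => le_rfl) hr')
      have ht' := Finset.mem_range.1 ht
      rw [← dre_magM _ hr' ht']
      exact mul_le_mul_of_nonneg_right (hcl r' hr' t ht') (hwnn t ht')
    exact TV.base.rowsum_window_le_of_coord cd_Kb cd_Ka (TV.PchM kitOf wT j ℓ (q' * L) (L / ℓ)) (fun t => r * vre (TV.wVec j L s₀ m) t)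
      (fun r' => r * vre (TV.wVec j L s₀ (m + 1)) r') hrow i' hk1' hk2'

omit hℓ hdvd hL hGR in
/-- **THE FINAL LEG**: from a bound `r·w` at the grid start `gb` of `b`'s sub-block to the (R2) instance with the factor
`facOf (prodM gb (b − gb)) w`. [folklore] -/
theorem final_leg {s₀ gb b q₀ : ℕ} (hs : s₀ ≤ gb) (hgb : gb ≤ b) {Ac : ℕ → Ker}
    (hA : ∀ s', gb ≤ s' → s' < b →
      KerMem (TV.toCertDataVW kitOf wT sc) (Ac s') ((TV.toBoxesW kitOf wT).Mlo j s') ((TV.toBoxesW kitOf wT).Mhi j s'))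
    {v : Fin 4 → ℤ → ℝ} {r : ℝ} (hr : 0 ≤ r) {w : Array Dyad}
    (hw : AbsLeW (TV.toCertDataVW kitOf wT sc) (kiter (TV.toCertDataVW kitOf wT sc) Ac s₀ (gb - s₀) v)
      (fun i k => r * vre w (TV.base.idx i k))) :
    (TV.toCertDataVW kitOf wT sc).InBall j (kiter (TV.toCertDataVW kitOf wT sc) Ac s₀ (b - s₀) v)
      (((TV.gctx j L q₀).facOf (TV.prodM kitOf wT j gb (b - gb)) w).toReal * r) := by
  rw [show b - s₀ = (gb - s₀) + (b - gb) by omega, kiter_add, show s₀ + (gb - s₀) = gb by omega]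
  have hmem := memMat_prodM (sc := sc) (j := j) (a := gb) (A := Ac) (b - gb) fun s' h1 h2 => hA s' h1 (by omega)
  have hK := TV.base.kerMem_of_memMat_kiter cd_Kb cd_Ka hmem
  have hb := absLeW_kiter_of_prodMem hK hw
  intro i k hk1 hk2
  refine (hb i k hk1 hk2).trans ?_
  set P := TV.prodM kitOf wT j gb (b - gb) with hP
  have hrow : ∀ r' < TV.base.n, ∑ t ∈ Finset.range TV.base.n, (IntervalD.mag (imget P r' t)).toReal * (r * vre w t) ≤
      ((TV.gctx j L q₀).facOf P w).toReal * r * (TV.toCertDataVW kitOf wT sc).ω j (TV.base.wk r') := by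
    intro r' hr'
    have e : ∑ t ∈ Finset.range TV.base.n, (IntervalD.mag (imget P r' t)).toReal * (r * vre w t) =
        r * ∑ t ∈ Finset.range TV.base.n, (IntervalD.mag (imget P r' t)).toReal * vre w t := by
      rw [Finset.mul_sum]; exact Finset.sum_congr rfl fun t _ => by ring
    rw [e]
    have hf := rowsum_le_facOf (sc := sc) j L q₀ hω P w hr'
    calc r * _ ≤ r * (((TV.gctx j L q₀).facOf P w).toReal * (TV.toCertDataVW kitOf wT sc).ω j (TV.base.wk r')) :=
        mul_le_mul_of_nonneg_left hf hr
      _ = _ := by ring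
  have hw' := TV.base.rowsum_window_le_of_coord cd_Kb cd_Ka P (fun t => r * vre w t) _ hrow i hk1 hk2
  refine hw'.trans (le_of_eq ?_)
  rw [TV.base.wk_idx i (by rw [← cd_Kb (TV := TV) (kitOf := kitOf) (wT := wT) (sc := sc),
    ← cd_Ka (TV := TV) (kitOf := kitOf) (wT := wT) (sc := sc)]; exact ⟨hk1, hk2⟩)]

/-- **(R2) from the two-level Booleans** (all pairs `s₀ ≤ s₁ ≤ S`). [folklore] -/
theorem hR2_of_growth2 (s₀ s₁ : ℕ) (h01 : s₀ ≤ s₁) (hS : s₁ ≤ TV.S j) (Ac : ℕ → Ker)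
    (hA : ∀ s', s₀ ≤ s' → s' < s₁ →
      KerMem (TV.toCertDataVW kitOf wT sc) (Ac s') ((TV.toBoxesW kitOf wT).Mlo j s') ((TV.toBoxesW kitOf wT).Mhi j s'))
    (v : Fin 4 → ℤ → ℝ) (r : ℝ) (hr : 0 ≤ r) (hv : (TV.toCertDataVW kitOf wT sc).InBall j v r) :
    (TV.toCertDataVW kitOf wT sc).InBall j (kiter (TV.toCertDataVW kitOf wT sc) Ac s₀ (s₁ - s₀) v)
      (TV.Gr2 kitOf wT j L ℓ s₀ s₁ * r) := by
  unfold Gr2 gD2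
  by_cases hin : s₁ ≤ (s₀ / ℓ + 1) * ℓ
  · -- same sub-block: direct product
    rw [if_pos hin]
    refine TV.base.inBall_kiter_of_memMat cd_Kb cd_Ka
      (memMat_prodM (sc := sc) (s₁ - s₀) fun s' h1 h2 => hA s' h1 (by omega)) (fun r' hr' => ?_) hr hv
    exact (rowsum_omega_le_ωhi (sc := sc) (j := j) _ hr').trans (rowsum_le_facOf (sc := sc) j L _ hω _ _ hr')
  rw [if_neg hin]
  simp only []
  push Not at hin
  -- the grid start of `s₁`'s sub-block
  set gb := (s₁ - 1) / ℓ * ℓ with hgbd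
  have hgb1 : gb ≤ s₁ - 1 := Nat.div_mul_le_self _ ℓ
  have hgb2 : s₁ - 1 < gb + ℓ := Nat.lt_div_mul_add hℓ
  have hg₀gb : (s₀ / ℓ + 1) * ℓ ≤ gb := by
    have hd : s₀ / ℓ + 1 ≤ (s₁ - 1) / ℓ := (Nat.le_div_iff_mul_le hℓ).2 (by omega)
    have hm : (s₀ / ℓ + 1) * ℓ ≤ (s₁ - 1) / ℓ * ℓ := Nat.mul_le_mul_right ℓ hd
    rwa [← hgbd] at hm
  have hs₀g : s₀ ≤ (s₀ / ℓ + 1) * ℓ := by have := Nat.lt_div_mul_add (a := s₀) hℓ; linarith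
  by_cases hsame : s₁ ≤ (s₀ / L + 1) * L
  · -- same chunk: in-chunk sub-block transport of the start vector
    rw [if_pos hsame]
    obtain ⟨m, hm⟩ : ∃ m, gb - (s₀ / ℓ + 1) * ℓ = m * ℓ := by
      have hd1 : ℓ ∣ gb := Dvd.intro_left _ rfl
      have hd2 : ℓ ∣ (s₀ / ℓ + 1) * ℓ := Dvd.intro_left _ rfl
      obtain ⟨c, hc⟩ := Nat.dvd_sub hd1 hd2
      exact ⟨c, by rw [hc, Nat.mul_comm]⟩
    have em : (gb - (s₀ / ℓ + 1) * ℓ) / ℓ = m := by rw [hm]; exact Nat.mul_div_cancel m hℓ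
    rw [em]
    have ht := vIn_transport (sc := sc) (j := j) (ℓ := ℓ) hℓ (a := s₀) m (Ac := Ac) (fun s' h1 h2 => hA s' h1 (by omega)) hr hv
    rw [show (s₀ / ℓ + 1) * ℓ + m * ℓ = gb by omega] at ht
    exact final_leg (sc := sc) (j := j) hω (by omega) (by omega) (fun s' h1 h2 => hA s' (by omega) h2) hr ht
  · -- later chunk: emitted chain to `qb·L`, then sub-blocks of chunk `qb`
    rw [if_neg hsame]
    push Not at hsame
    set qb := (s₁ - 1) / L with hqbd
    have hb1 : qb * L ≤ s₁ - 1 := Nat.div_mul_le_self _ L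
    have hb2 : s₁ - 1 < qb * L + L := Nat.lt_div_mul_add hL
    have hq : s₀ / L + 1 ≤ qb := (Nat.le_div_iff_mul_le hL).2 (by omega)
    obtain ⟨M, hM⟩ := Nat.exists_eq_add_of_le hq
    have hmS : (s₀ / L + 1 + M) * L < TV.S j := by rw [← hM]; omega
    have ht := (transport_bound2 (TV := TV) (kitOf := kitOf) (wT := wT) (sc := sc) hℓ hdvd hL hGR hω M hmS Ac
      (fun s' h1' h2' => hA s' h1' (by rw [← hM] at h2'; omega)) v r hr hv).1
    rw [← hM] at ht
    have eM : qb - (s₀ / L + 1) = M := by omega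
    -- sub-blocks of chunk `qb` from `qb·L` to `gb`
    have hCg : qb * L ≤ gb := chunk_le_grid hdvd hb1
    obtain ⟨m', hm'⟩ : ∃ m', gb - qb * L = m' * ℓ := by
      have hd1 : ℓ ∣ gb := Dvd.intro_left _ rfl
      have hd2 : ℓ ∣ qb * L := Dvd.dvd.mul_left hdvd _
      obtain ⟨c, hc⟩ := Nat.dvd_sub hd1 hd2
      exact ⟨c, by rw [hc, Nat.mul_comm]⟩
    have em' : (gb - qb * L) / ℓ = m' := by rw [hm']; exact Nat.mul_div_cancel m' hℓ
    rw [em']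
    have hs₀q : s₀ ≤ qb * L := by
      have hm := Nat.mul_le_mul_right L hq
      have eC : (s₀ / L + 1) * L = s₀ / L * L + L := by ring
      have h2 : s₀ < s₀ / L * L + L := Nat.lt_div_mul_add hL
      omega
    have ht2 := vSub_transport (sc := sc) (j := j) (ℓ := ℓ) (s₀ := s₀) (g := qb * L) hs₀q hr (TV.wVec j L s₀ M) m' Ac
      (fun s' h1 h2 => hA s' (by omega) (by omega)) ht
    rw [show qb * L + m' * ℓ = gb by omega] at ht2
    unfold vOut
    rw [eM]
    exact final_leg (sc := sc) (j := j) hω (by omega) (by omega) (fun s' h1 h2 => hA s' (by omega) h2) hr ht2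

/-! ### The composer's inputs for all stages (two-level) -/

end Stage2

section All2

variable {Pj : ℕ → ℕ → CoreOut → Bool} {L ℓ : ℕ} (hℓ : 0 < ℓ) (hdvd : ℓ ∣ L) (hL : 0 < L)
  (hGR : ∀ j, j ≤ TV.base.N₀ → ∀ q, q * L < TV.S j → TV.growthRange2 kitOf wT (Pj j) j L ℓ q = true)
  (hcL : ∀ j, j ≤ TV.base.N₀ → TV.checkL1 j = true)
  (hSN : (TV.toCertDataVW kitOf wT sc).StageNumerics)
include hℓ hdvd hL hGR

include hSN in
/-- (R2) for all stages, two-level. [folklore] -/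
theorem hR2_all2 : ∀ j, j ≤ TV.base.N₀ → ∀ s₀ s₁, s₀ ≤ s₁ → s₁ ≤ (TV.toCertDataVW kitOf wT sc).S j → ∀ Ac : ℕ → Ker,
    (∀ s', s₀ ≤ s' → s' < s₁ →
      KerMem (TV.toCertDataVW kitOf wT sc) (Ac s') ((TV.toBoxesW kitOf wT).Mlo j s') ((TV.toBoxesW kitOf wT).Mhi j s')) →
    ∀ (v : Fin 4 → ℤ → ℝ) (r : ℝ), 0 ≤ r → (TV.toCertDataVW kitOf wT sc).InBall j v r →
      (TV.toCertDataVW kitOf wT sc).InBall j (kiter (TV.toCertDataVW kitOf wT sc) Ac s₀ (s₁ - s₀) v)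
        (TV.Gr2 kitOf wT j L ℓ s₀ s₁ * r) :=
  fun j hj s₀ s₁ h01 hS Ac hA v r hr hv =>
    hR2_of_growth2 (sc := sc) hℓ hdvd hL (hGR j hj) (hSN.1 j hj).2.2.2.2.2.2.1 s₀ s₁ h01 hS Ac hA v r hr hv

/-- (R3a) for all stages, two-level. [folklore] -/
theorem hR3a_all2 : ∀ j, j ≤ TV.base.N₀ → ∀ a b, a < (TV.toCertDataVW kitOf wT sc).S j → a + 1 ≤ b →
    b ≤ (TV.toCertDataVW kitOf wT sc).S j →
    (TV.toCertDataVW kitOf wT sc).L1 j a * TV.Gr2 kitOf wT j L ℓ (a + 1) b ≤ TV.ΛTr j ∧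
    (b < (TV.toCertDataVW kitOf wT sc).S j →
      (TV.toCertDataVW kitOf wT sc).L1 j a * TV.Gr2 kitOf wT j L ℓ (a + 1) b * (TV.toCertDataVW kitOf wT sc).L1 j b ≤
        (TV.toCertDataVW kitOf wT sc).Λ j) :=
  fun j hj a b ha hab hb => hR3a_of_growth2 (sc := sc) hℓ hdvd hL (hGR j hj) a b ha hab hb

include hcL in
/-- (R3b) for all stages, two-level (with `0 ≤ L1`). [folklore] -/
theorem hR3b_all2 : ∀ j, j ≤ TV.base.N₀ → ∀ a, a < (TV.toCertDataVW kitOf wT sc).S j →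
    (TV.toCertDataVW kitOf wT sc).L1 j a ≤ (TV.toCertDataVW kitOf wT sc).Λ j ∧ 0 ≤ (TV.toCertDataVW kitOf wT sc).L1 j a :=
  fun j hj a ha => ⟨hR3b_of_growth2 (sc := sc) hℓ hdvd hL (hGR j hj) (hcL j hj) a ha,
    by rw [cd_L1]; exact (L1_bounds2 (TV := TV) (kitOf := kitOf) (wT := wT) hℓ hdvd hL (hGR j hj) a ha).2⟩

/-- The two-level runs also deliver `ChecksOK.steps` and the caller's predicate. [folklore] -/
theorem steps_of_growth2 : ∀ j, j ≤ TV.base.N₀ → ∀ s, s < TV.S j →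
    Pj j s ((TV.ctxOfW kitOf wT j).subStep s ((TV.ctxOfW kitOf wT j).nodeAt s)).core = true ∧
    ((TV.ctxOfW kitOf wT j).subStep s ((TV.ctxOfW kitOf wT j).nodeAt s)).ok = true := by
  intro j hj s hs
  obtain ⟨h1, h2, -⟩ := facts_at2 (TV := TV) (kitOf := kitOf) (wT := wT) hℓ hdvd hL (hGR j hj) hs
  exact ⟨h2, h1⟩

end All2

end CertTablesV

end Summit.NavierStokesRegularity.NavierStokesRegularity.Theorems.TaylorModelCert
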